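import Summits.CriticalPhenomena.PercolationContinuityZ3.Theorems.PercNearOneGluingNoHeavyLowerTailTwoLevelPackingCardSubTwoTools
import HarnessLib

/-!
# `NoHeavyLowerTail` (stmt-CriticalPhenomena-4575) — two-level packing at level `|A| − 2`: the fragmented-world transfer

Support file (lemma factory #8 `prim-lf-8`, gen 5; `--supports stmt-CriticalPhenomena-4575`).  No definitions, no named
facts, no sorries.  Notation of `…TwoLevelPackingCardSubTwoTools.lean`: `μ = prodBernoulli w` on `Fin n`, relays `A`
(`k = |A| ≥ 3`), observer `o`, level `k − 2`; `R_c = {|π(c)| ≤ k−2}`, `D_c = {c ↮ A∖c}`, `Q_c = {A∖c pairwise joined}`,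
`H_c = D_c ∩ Q_c`, `U = ⋃_{b ∈ A∖c} {o ↔ b}`, `L = {1 ≤ N ≤ k−2}`, `F = {o ↮ c}`.

At level `k − 2` the light event splits as `R_c = M ⊔ H_c` with `M = R_c ∖ H_c = {no relay block of size ≥ k−1}`
(the FRAGMENTED world, the same event for every relay).  The new ingredient of the level-`(k−2)` two-level packing:

* `fragmented_transfer` — **`μ(F ∩ L ∩ R_c) · μ(H_c) ≤ μ(R_c ∖ H_c) · μ(D_c ∩ U ∩ Q_c)`**, i.e.
  `μ(o ↔ A∖c, o ↮ c | fragmented) ≤ μ(o ↔ A∖c | c isolated, A∖c joined)`, for EVERY relay `c` (no championship).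

Proof: partition the fragmented world by the relay block `B = π(c)` (`block_piece_le`).  For `B = {c}` it is the
positive correlation of `U` and `Q_c` given `D_c` (set-BHK, `AttachedChampionCardSubTwo.touch_connAll_posCorr`).  For
`|B| ≥ 2`, `T = A ∖ B`: `μ(o ↔ T | π(c) = B) ≤ μ(o ↔ T | c ↮ T)` (block/attachment exchange), `≤ μ(o ↔ T | c ↮ A∖c)`
(cut exchange), `≤ μ(U | D_c) ≤ μ(U | D_c ∩ Q_c)`.  Seat census (exact rationals, lab/topcell_T4b.py): 0 violations in
585 champion + 1 277 non-champion instances and 20 669 per-block instances, `k = 4, 5, 6`.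
-/

noncomputable section

namespace Summit.CriticalPhenomena.PercolationContinuityZ3.Theorems

open MeasureTheory Set Filter Literature.Probability.LatticeModels Literature.Probability.Percolation
open scoped Classical BigOperators Topology

namespace TwoLevelPackingCardSubTwo

variable {n : ℕ}

/-- `c`'s relay block always contains `c` (for `c ∈ A`). [folklore] -/
theorem mem_block_self (A : Finset (Fin n)) {c : Fin n} (hc : c ∈ A) (ω : BondConfig (Fin n)) :
    c ∈ A.filter fun z => ω ∈ openConn c z :=
  Finset.mem_filter.2 ⟨hc, (SimpleGraph.Reachable.refl c : (openGraph ω).Reachable c c)⟩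

/-- The block of `c` is `{c}` iff `c` is isolated from `A ∖ c` (`c ∈ A`). [folklore] -/
theorem block_eq_singleton_iff (A : Finset (Fin n)) {c : Fin n} (hc : c ∈ A) (ω : BondConfig (Fin n)) :
    (A.filter fun z => ω ∈ openConn c z) = {c} ↔ ∀ t ∈ A.erase c, ω ∉ openConn c t := by
  constructor
  · intro h t ht hct
    obtain ⟨htc, htA⟩ := Finset.mem_erase.1 ht
    have : t ∈ A.filter fun z => ω ∈ openConn c z := Finset.mem_filter.2 ⟨htA, hct⟩
    rw [h, Finset.mem_singleton] at this
    exact htc this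
  · intro h
    refine Finset.eq_singleton_iff_unique_mem.2 ⟨mem_block_self A hc ω, fun z hz => ?_⟩
    obtain ⟨hzA, hcz⟩ := Finset.mem_filter.1 hz
    by_contra hzc
    exact h z (Finset.mem_erase.2 ⟨hzc, hzA⟩) hcz

/-- Four-term cancellation: from `p q ≤ r s`, `s d ≤ q e`, `e h ≤ d g` (all nonnegative, `p ≤ r ≤ q`, `h ≤ d`) conclude
`p h ≤ r g`. [folklore] -/
theorem chain_cancel {p q r s d e h g : ℝ} (hp : 0 ≤ p) (hq : 0 ≤ q) (hr : 0 ≤ r) (_hs : 0 ≤ s) (hd : 0 ≤ d)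
    (_he : 0 ≤ e) (hh : 0 ≤ h) (hg : 0 ≤ g) (hpr : p ≤ r) (hrq : r ≤ q) (hhd : h ≤ d)
    (h1 : p * q ≤ r * s) (h2 : s * d ≤ q * e) (h3 : e * h ≤ d * g) : p * h ≤ r * g := by
  rcases hq.eq_or_lt with hq0 | hqpos
  · have hr0 : r = 0 := le_antisymm (hq0 ▸ hrq) hr
    have hp0 : p = 0 := le_antisymm (hr0 ▸ hpr) hp
    rw [hp0, hr0]; simp
  rcases hd.eq_or_lt with hd0 | hdpos
  · have hh0 : h = 0 := le_antisymm (hd0 ▸ hhd) hh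
    rw [hh0, mul_zero]; exact mul_nonneg hr hg
  have key : p * h * (q * d) ≤ r * g * (q * d) := by
    calc p * h * (q * d) = (p * q) * h * d := by ring
      _ ≤ (r * s) * h * d := by
          have := mul_le_mul_of_nonneg_right (mul_le_mul_of_nonneg_right h1 hh) hd; linarith
      _ = r * h * (s * d) := by ring
      _ ≤ r * h * (q * e) := mul_le_mul_of_nonneg_left h2 (mul_nonneg hr hh)
      _ = r * q * (e * h) := by ring
      _ ≤ r * q * (d * g) := mul_le_mul_of_nonneg_left h3 (mul_nonneg hr hq)
      _ = r * g * (q * d) := by ring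
  exact le_of_mul_le_mul_right key (mul_pos hqpos hdpos)

/-- **The per-block bound.**  For every `B ⊆ A`:
`μ(F ∩ L ∩ R_c ∩ {π(c) = B}) · μ(H_c) ≤ μ((R_c ∖ H_c) ∩ {π(c) = B}) · μ(D_c ∩ (U ∩ Q_c))`. [this work] -/
theorem block_piece_le (w : Sym2 (Fin n) → unitInterval) (A : Finset (Fin n)) (o c : Fin n) (hc : c ∈ A)
    (hk : 3 ≤ A.card) (B : Finset (Fin n)) (hBA : B ⊆ A) :
    (prodBernoulli w).real (((openConn o c : Set (BondConfig (Fin n)))ᶜ ∩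
          {ω | 1 ≤ (A.filter fun x => ω ∈ openConn o x).card ∧
            (A.filter fun x => ω ∈ openConn o x).card ≤ A.card - 2} ∩
          {ω | (A.filter fun x => ω ∈ openConn c x).card ≤ A.card - 2}) ∩
        {ω | (A.filter fun z => ω ∈ openConn c z) = B}) *
      (prodBernoulli w).real ({ω : BondConfig (Fin n) | ∀ t ∈ A.erase c, ω ∉ openConn c t} ∩
        {ω | ∀ t ∈ (↑(A.erase c) : Set (Fin n)), ∀ t' ∈ (↑(A.erase c) : Set (Fin n)), ω ∈ openConn t t'}) ≤
    (prodBernoulli w).real (({ω : BondConfig (Fin n) | (A.filter fun x => ω ∈ openConn c x).card ≤ A.card - 2} \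
          ({ω : BondConfig (Fin n) | ∀ t ∈ A.erase c, ω ∉ openConn c t} ∩
            {ω | ∀ t ∈ (↑(A.erase c) : Set (Fin n)), ∀ t' ∈ (↑(A.erase c) : Set (Fin n)), ω ∈ openConn t t'})) ∩
        {ω | (A.filter fun z => ω ∈ openConn c z) = B}) *
      (prodBernoulli w).real ({ω : BondConfig (Fin n) | ∀ t ∈ A.erase c, ω ∉ openConn c t} ∩
        ((⋃ b ∈ A.erase c, openConn o b) ∩
          {ω | ∀ t ∈ (↑(A.erase c) : Set (Fin n)), ∀ t' ∈ (↑(A.erase c) : Set (Fin n)), ω ∈ openConn t t'})) := by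
  set μ := prodBernoulli w with hμ
  set F : Set (BondConfig (Fin n)) := (openConn o c : Set (BondConfig (Fin n)))ᶜ with hF
  set L : Set (BondConfig (Fin n)) := {ω | 1 ≤ (A.filter fun x => ω ∈ openConn o x).card ∧
    (A.filter fun x => ω ∈ openConn o x).card ≤ A.card - 2} with hL
  set Rc : Set (BondConfig (Fin n)) := {ω | (A.filter fun x => ω ∈ openConn c x).card ≤ A.card - 2} with hRc
  set Dc : Set (BondConfig (Fin n)) := {ω | ∀ t ∈ A.erase c, ω ∉ openConn c t} with hDc
  set Qc : Set (BondConfig (Fin n)) :=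
    {ω | ∀ t ∈ (↑(A.erase c) : Set (Fin n)), ∀ t' ∈ (↑(A.erase c) : Set (Fin n)), ω ∈ openConn t t'} with hQc
  set U : Set (BondConfig (Fin n)) := ⋃ b ∈ A.erase c, openConn o b with hU
  set Blk : Set (BondConfig (Fin n)) := {ω | (A.filter fun z => ω ∈ openConn c z) = B} with hBlk
  have hmeas : ∀ s : Set (BondConfig (Fin n)), MeasurableSet s := fun _ => MeasurableSet.of_discrete
  have hnn : ∀ s : Set (BondConfig (Fin n)), 0 ≤ μ.real s := fun _ => measureReal_nonneg
  have hmono : ∀ {s t : Set (BondConfig (Fin n))}, s ⊆ t → μ.real s ≤ μ.real t :=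
    fun hst => measureReal_mono hst (measure_ne_top μ _)
  -- the positive correlation of `U` and `Q_c` given `D_c`
  have hpos : μ.real (Dc ∩ U) * μ.real (Dc ∩ Qc) ≤ μ.real Dc * μ.real (Dc ∩ (U ∩ Qc)) := by
    have hQ : Qc = {ω : BondConfig (Fin n) | ∀ t ∈ A.erase c, ∀ t' ∈ A.erase c, ω ∈ openConn t t'} := rfl
    rw [hQ]
    exact AttachedChampionCardSubTwo.touch_connAll_posCorr w (A.erase c) c o
  by_cases hcB : c ∈ B
  swap
  · -- `c ∉ B`: the block of `c` is never `B`
    have hempty : F ∩ L ∩ Rc ∩ Blk = ∅ := by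
      refine Set.eq_empty_iff_forall_notMem.2 fun ω hω => hcB ?_
      have h : (A.filter fun z => ω ∈ openConn c z) = B := hω.2
      rw [← h]; exact mem_block_self A hc ω
    rw [hempty, measureReal_empty, zero_mul]
    exact mul_nonneg (hnn _) (hnn _)
  by_cases hB1 : B = {c}
  · -- `B = {c}`: `c` isolated; positive correlation of `U` and `Q_c` given `D_c`
    have hBlkD : Blk = Dc := by
      ext ω; rw [hBlk, mem_setOf_eq, hB1]; exact block_eq_singleton_iff A hc ω
    have hsub1 : F ∩ L ∩ Rc ∩ Blk ⊆ (Dc ∩ U) \ (Dc ∩ Qc) := by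
      rintro ω ⟨⟨⟨hoc, h1, hle⟩, -⟩, hD⟩
      rw [hBlkD] at hD
      obtain ⟨a, ha⟩ := Finset.card_pos.1 h1
      obtain ⟨haA, hoa⟩ := Finset.mem_filter.1 ha
      have hac : a ≠ c := fun h => hoc (h ▸ hoa)
      refine ⟨⟨hD, mem_iUnion₂.2 ⟨a, Finset.mem_erase.2 ⟨hac, haA⟩, hoa⟩⟩, fun hQ => ?_⟩
      have hsub : A.erase c ⊆ A.filter fun x => ω ∈ openConn o x := by
        intro t ht
        refine Finset.mem_filter.2 ⟨Finset.mem_of_mem_erase ht, ?_⟩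
        have hat : (openGraph ω).Reachable a t := hQ.2 a (Finset.mem_erase.2 ⟨hac, haA⟩) t ht
        exact ((show (openGraph ω).Reachable o a from hoa).trans hat : (openGraph ω).Reachable o t)
      have := Finset.card_le_card hsub
      rw [Finset.card_erase_of_mem hc] at this
      omega
    have hsub2 : Dc \ (Dc ∩ Qc) ⊆ (Rc \ (Dc ∩ Qc)) ∩ Blk := by
      rintro ω ⟨hD, hnH⟩
      rw [hBlkD]
      refine ⟨⟨?_, hnH⟩, hD⟩
      show (A.filter fun x => ω ∈ openConn c x).card ≤ A.card - 2
      rw [(block_eq_singleton_iff A hc ω).2 hD, Finset.card_singleton]; omega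
    have e1 : μ.real ((Dc ∩ U) \ (Dc ∩ Qc)) = μ.real (Dc ∩ U) - μ.real (Dc ∩ (U ∩ Qc)) := by
      have h := measureReal_inter_add_sdiff (μ := μ) (s := Dc ∩ U) (t := Dc ∩ Qc) (hmeas _)
      have h' : Dc ∩ U ∩ (Dc ∩ Qc) = Dc ∩ (U ∩ Qc) := by
        ext ω; simp only [mem_inter_iff]; tauto
      rw [h'] at h; linarith
    have e2 : μ.real (Dc \ (Dc ∩ Qc)) = μ.real Dc - μ.real (Dc ∩ Qc) := by
      have h := measureReal_inter_add_sdiff (μ := μ) (s := Dc) (t := Dc ∩ Qc) (hmeas _)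
      have h' : Dc ∩ (Dc ∩ Qc) = Dc ∩ Qc := by
        ext ω; simp only [mem_inter_iff]; tauto
      rw [h'] at h; linarith
    -- `a₂ d₁ ≤ d₂ a₁`
    have key : μ.real ((Dc ∩ U) \ (Dc ∩ Qc)) * μ.real (Dc ∩ Qc) ≤
        μ.real (Dc \ (Dc ∩ Qc)) * μ.real (Dc ∩ (U ∩ Qc)) := by
      rw [e1, e2]; nlinarith [hpos]
    calc μ.real (F ∩ L ∩ Rc ∩ Blk) * μ.real (Dc ∩ Qc)
        ≤ μ.real ((Dc ∩ U) \ (Dc ∩ Qc)) * μ.real (Dc ∩ Qc) := mul_le_mul_of_nonneg_right (hmono hsub1) (hnn _)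
      _ ≤ μ.real (Dc \ (Dc ∩ Qc)) * μ.real (Dc ∩ (U ∩ Qc)) := key
      _ ≤ μ.real ((Rc \ (Dc ∩ Qc)) ∩ Blk) * μ.real (Dc ∩ (U ∩ Qc)) :=
          mul_le_mul_of_nonneg_right (hmono hsub2) (hnn _)
  · -- `c ∈ B`, `B ≠ {c}`: a relay `b ≠ c` in `B`; put `T = A ∖ B`
    set T : Finset (Fin n) := A \ B with hT
    set DT : Set (BondConfig (Fin n)) := {ω | ∀ t ∈ T, ω ∉ openConn c t} with hDT
    set OT : Set (BondConfig (Fin n)) := ⋃ t ∈ T, (openConn o t : Set (BondConfig (Fin n))) with hOT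
    set JB : Set (BondConfig (Fin n)) := {ω | ∀ b ∈ B, ω ∈ openConn c b} with hJB
    set CB : Set (BondConfig (Fin n)) := {ω | ∀ b ∈ B.erase c, ω ∉ openConn c b} with hCB
    have hBlk_eq : Blk = DT ∩ JB := by
      ext ω; exact blockEq_iff A B c hBA ω
    have hDc_eq : DT ∩ CB = Dc := by
      ext ω
      simp only [hDT, hCB, hDc, mem_inter_iff, mem_setOf_eq]
      constructor
      · rintro ⟨h1, h2⟩ t ht
        by_cases htB : t ∈ B
        · exact h2 t (Finset.mem_erase.2 ⟨(Finset.mem_erase.1 ht).1, htB⟩)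
        · exact h1 t (Finset.mem_sdiff.2 ⟨Finset.mem_of_mem_erase ht, htB⟩)
      · intro h
        refine ⟨fun t ht => h t (Finset.mem_erase.2 ⟨?_, (Finset.mem_sdiff.1 ht).1⟩),
          fun b hb => h b (Finset.mem_erase.2 ⟨(Finset.mem_erase.1 hb).1, hBA (Finset.mem_of_mem_erase hb)⟩)⟩
        rintro rfl; exact (Finset.mem_sdiff.1 ht).2 hcB
    have hOT_U : Dc ∩ OT ⊆ Dc ∩ U := by
      rintro ω ⟨hD, hO⟩
      obtain ⟨t, ht, hot⟩ := mem_iUnion₂.1 hO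
      refine ⟨hD, mem_iUnion₂.2 ⟨t, Finset.mem_erase.2 ⟨?_, (Finset.mem_sdiff.1 ht).1⟩, hot⟩⟩
      rintro rfl; exact (Finset.mem_sdiff.1 ht).2 hcB
    by_cases hBcard : A.card - 2 < B.card
    · -- heavy block: contradicts `R_c`
      have hempty : F ∩ L ∩ Rc ∩ Blk = ∅ := by
        refine Set.eq_empty_iff_forall_notMem.2 fun ω hω => ?_
        have hR : (A.filter fun x => ω ∈ openConn c x).card ≤ A.card - 2 := hω.1.2
        have hB : (A.filter fun z => ω ∈ openConn c z) = B := hω.2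
        rw [hB] at hR; omega
      rw [hempty, measureReal_empty, zero_mul]
      exact mul_nonneg (hnn _) (hnn _)
    · rw [not_lt] at hBcard
      -- `F ∩ L ∩ R_c ∩ {π(c) = B} ⊆ {π(c) = B} ∩ O_T`
      have hsub1 : F ∩ L ∩ Rc ∩ Blk ⊆ DT ∩ (JB ∩ OT) := by
        rintro ω ⟨⟨⟨hoc, h1, -⟩, -⟩, hB⟩
        have hB' : ω ∈ DT ∩ JB := hBlk_eq ▸ hB
        refine ⟨hB'.1, hB'.2, ?_⟩
        obtain ⟨a, ha⟩ := Finset.card_pos.1 h1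
        obtain ⟨haA, hoa⟩ := Finset.mem_filter.1 ha
        have haB : a ∉ B := by
          intro haB
          have hca : (openGraph ω).Reachable c a := hB'.2 a haB
          exact hoc ((show (openGraph ω).Reachable o a from hoa).trans hca.symm)
        exact mem_iUnion₂.2 ⟨a, Finset.mem_sdiff.2 ⟨haA, haB⟩, hoa⟩
      -- `{π(c) = B} ⊆ (R_c ∖ H_c) ∩ {π(c) = B}`
      have hsub2 : DT ∩ JB ⊆ (Rc \ (Dc ∩ Qc)) ∩ Blk := by
        intro ω hω
        have hB : ω ∈ Blk := hBlk_eq ▸ hω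
        have hB' : (A.filter fun z => ω ∈ openConn c z) = B := hB
        refine ⟨⟨?_, ?_⟩, hB⟩
        · show (A.filter fun x => ω ∈ openConn c x).card ≤ A.card - 2
          rw [hB']; exact hBcard
        · rintro ⟨hD, -⟩
          have : (A.filter fun z => ω ∈ openConn c z) = {c} := (block_eq_singleton_iff A hc ω).2 hD
          exact hB1 (hB'.symm.trans this)
      -- the exchange chain
      have h1 : μ.real (DT ∩ (JB ∩ OT)) * μ.real DT ≤ μ.real (DT ∩ JB) * μ.real (DT ∩ OT) :=
        blockEq_exchange w B T o c
      have h2 : μ.real (DT ∩ OT) * μ.real (DT ∩ CB) ≤ μ.real DT * μ.real (DT ∩ (CB ∩ OT)) :=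
        cut_exchange w (B.erase c) T o c
      have h2' : μ.real (DT ∩ OT) * μ.real Dc ≤ μ.real DT * μ.real (Dc ∩ OT) := by
        rw [← hDc_eq, Set.inter_assoc]; exact h2
      have h3 : μ.real (Dc ∩ OT) * μ.real (Dc ∩ Qc) ≤ μ.real Dc * μ.real (Dc ∩ (U ∩ Qc)) :=
        (mul_le_mul_of_nonneg_right (hmono hOT_U) (hnn _)).trans hpos
      have key : μ.real (DT ∩ (JB ∩ OT)) * μ.real (Dc ∩ Qc) ≤ μ.real (DT ∩ JB) * μ.real (Dc ∩ (U ∩ Qc)) :=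
        chain_cancel (hnn _) (hnn _) (hnn _) (hnn _) (hnn _) (hnn _) (hnn _) (hnn _)
          (hmono fun ω hω => ⟨hω.1, hω.2.1⟩) (hmono Set.inter_subset_left) (hmono Set.inter_subset_left) h1 h2' h3
      calc μ.real (F ∩ L ∩ Rc ∩ Blk) * μ.real (Dc ∩ Qc)
          ≤ μ.real (DT ∩ (JB ∩ OT)) * μ.real (Dc ∩ Qc) := mul_le_mul_of_nonneg_right (hmono hsub1) (hnn _)
        _ ≤ μ.real (DT ∩ JB) * μ.real (Dc ∩ (U ∩ Qc)) := key
        _ ≤ μ.real ((Rc \ (Dc ∩ Qc)) ∩ Blk) * μ.real (Dc ∩ (U ∩ Qc)) :=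
            mul_le_mul_of_nonneg_right (hmono hsub2) (hnn _)

/-- **The fragmented-world transfer** (every relay `c ∈ A`, `|A| ≥ 3`):
`μ(F ∩ L ∩ R_c) · μ(D_c ∩ Q_c) ≤ μ(R_c ∖ (D_c ∩ Q_c)) · μ(D_c ∩ (U ∩ Q_c))`. [this work] -/
theorem fragmented_transfer (w : Sym2 (Fin n) → unitInterval) (A : Finset (Fin n)) (o c : Fin n) (hc : c ∈ A)
    (hk : 3 ≤ A.card) :
    (prodBernoulli w).real ((openConn o c : Set (BondConfig (Fin n)))ᶜ ∩
          {ω | 1 ≤ (A.filter fun x => ω ∈ openConn o x).card ∧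
            (A.filter fun x => ω ∈ openConn o x).card ≤ A.card - 2} ∩
          {ω | (A.filter fun x => ω ∈ openConn c x).card ≤ A.card - 2}) *
      (prodBernoulli w).real ({ω : BondConfig (Fin n) | ∀ t ∈ A.erase c, ω ∉ openConn c t} ∩
        {ω | ∀ t ∈ (↑(A.erase c) : Set (Fin n)), ∀ t' ∈ (↑(A.erase c) : Set (Fin n)), ω ∈ openConn t t'}) ≤
    (prodBernoulli w).real ({ω : BondConfig (Fin n) | (A.filter fun x => ω ∈ openConn c x).card ≤ A.card - 2} \
          ({ω : BondConfig (Fin n) | ∀ t ∈ A.erase c, ω ∉ openConn c t} ∩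
            {ω | ∀ t ∈ (↑(A.erase c) : Set (Fin n)), ∀ t' ∈ (↑(A.erase c) : Set (Fin n)), ω ∈ openConn t t'})) *
      (prodBernoulli w).real ({ω : BondConfig (Fin n) | ∀ t ∈ A.erase c, ω ∉ openConn c t} ∩
        ((⋃ b ∈ A.erase c, openConn o b) ∩
          {ω | ∀ t ∈ (↑(A.erase c) : Set (Fin n)), ∀ t' ∈ (↑(A.erase c) : Set (Fin n)), ω ∈ openConn t t'})) := by
  rw [real_eq_sum_blocks w A c ((openConn o c : Set (BondConfig (Fin n)))ᶜ ∩ _ ∩ _),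
    real_eq_sum_blocks w A c ({ω : BondConfig (Fin n) | (A.filter fun x => ω ∈ openConn c x).card ≤ A.card - 2} \ _),
    Finset.sum_mul, Finset.sum_mul]
  exact Finset.sum_le_sum fun B hB => block_piece_le w A o c hc hk B (Finset.mem_powerset.1 hB)

end TwoLevelPackingCardSubTwo

end Summit.CriticalPhenomena.PercolationContinuityZ3.Theorems

end
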